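import Summits.AtomisticToContinuum.HydrodynamicLimit.Theorems.ImplosionDichotomyDiluteSelfConsistencyPdeForm
import Summits.AtomisticToContinuum.HydrodynamicLimit.Theorems.DiluteSelfConsistency.Negative.Tightness
import Summits.AtomisticToContinuum.HydrodynamicLimit.Theorems.ImplosionDichotomyDiluteSelfConsistencyNonsmoothVacuous

/-!
# `DiluteSelfConsistency` and `DenseExcursion` reduce to SMOOTH profiles (stmt-3091 / stmt-12586)

Support lemmas for the crux `ImplosionDichotomy.DiluteSelfConsistency` (stmt-AtomisticToContinuum-3091), line `birth`
(rev c2), from its landed stub `stub_nonsmoothVacuous` (`ImplosionDichotomyDiluteSelfConsistencyNonsmoothVacuous.lean`: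
continuous-but-not-smooth profiles carry no classical hard-sphere-Euler solution with the pinned data on a nonempty
`[0, T)`). Consequences, in the crux's own vocabulary (`DiluteSelfConsistencyHoldsAt`, `Negative/Tightness.lean`):

* `holdsAt_of_not_smooth` — at non-smooth profiles the crux's inner clause holds VACUOUSLY (data pinning
  `admissible_iff_data` + the stub).
* `diluteSelfConsistency_iff_smooth` (registered sub-goal) — **the crux IS its smooth-profile version**: replacing
  `Continuous a₀ / θ₀ / u₀` by `Torus.IsSmooth` gives an equivalent statement. This DECIDES the standing disprover's open
  mutation (cdisprove cycle 1, `Cruxes/DiluteSelfConsistency/Disproof.lean`: "continuity hyps probably vacuous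
  extensions — undecidable cheaply"): they are vacuous extensions; regularity of the profiles is not load-bearing.
* `diluteSelfConsistency_iff_pde_smooth` — the particle-free form (`diluteSelfConsistency_iff_pde`) at smooth profiles.
* `denseExcursion_iff_smooth` — the sibling crux `DenseExcursion` (stmt-12586) needs only SMOOTH profile witnesses.
* `diluteSelfConsistency_iff_smoothIdealFate` / `denseExcursion_of_not_smoothIdealFate` — the rev-c2 cut of line `birth`
  (Cases I/II for smooth profiles, the two remaining registered stubs verbatim) is EXACT; a kill of either is `DenseExcursion`.

prover-line-stmt-AtomisticToContinuum-3091-c2-0 (line `birth`, rev c2).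
-/

noncomputable section

namespace Summit.AtomisticToContinuum.HydrodynamicLimit.Theorems

open MeasureTheory Filter Set Topology
open Literature.MathematicalPhysics.KineticTheory Literature.Analysis.FluidPDE
open Literature.Analysis.FunctionSpaces
open Summit.AtomisticToContinuum.HydrodynamicLimit.Theses.ImplosionDichotomy (DiluteSelfConsistency DenseExcursion)
open PolynomialCompressionPDE (Flows admissible_iff_data continuous_slices_zero flows_nonempty)
open DenseExcursionDichotomy (tendstoHydroFieldsAt_zero_transfer)

namespace DiluteSelfConsistencySmoothReduction

/-- **At non-smooth profiles the crux's inner clause holds vacuously** : below `min σ₁ σ₀` (statics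
threshold and the stub's threshold) no classical solution on a nonempty `[0, T)` is tied to the local Gibbs laws. -/
theorem holdsAt_of_not_smooth {a₀ θ₀ : T3 → ℝ} {u₀ : T3 → V3} (ha : Continuous a₀)
    (hθ : Continuous θ₀) (hu : Continuous u₀) (ha0 : ∀ x, 0 < a₀ x) (hθ0 : ∀ x, 0 < θ₀ x)
    (hns : ¬ (Torus.IsSmooth a₀ ∧ Torus.IsSmooth θ₀ ∧ Torus.IsSmooth u₀)) (η : ℝ) :
    ∃ σ₀ : ℝ, 0 < σ₀ ∧ DiluteSelfConsistencyHoldsAt η a₀ θ₀ u₀ σ₀ := by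
  obtain ⟨σ₂, hσ₂, H⟩ := stub_nonsmoothVacuous a₀ θ₀ u₀ ha ha0 hθ hu hθ0 hns
  obtain ⟨σ₁, hσ₁, -, G⟩ := admissible_iff_data ha hθ hu ha0 hθ0
  refine ⟨min σ₁ σ₂, lt_min hσ₁ hσ₂, fun σ hσ hσlt T ρ θ u hE Φ htie t ht _ => ?_⟩
  have hσ₁' : σ < σ₁ := lt_of_lt_of_le hσlt (min_le_left _ _)
  have hσ₂' : σ < σ₂ := lt_of_lt_of_le hσlt (min_le_right _ _)
  have hT : 0 < T := ht.1.trans_lt ht.2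
  obtain ⟨hρc, huc, hθc⟩ := continuous_slices_zero hE hT
  have hall : ∀ Ψ : Flows σ, TendstoHydroFieldsAt (fun N => localGibbsLaw σ a₀ u₀ θ₀ N (Ψ N)) Ψ ρ u θ 0 :=
    fun Ψ => tendstoHydroFieldsAt_zero_transfer Φ Ψ htie
  obtain ⟨-, G'⟩ := G σ hσ hσ₁'
  obtain ⟨h1, h2, h3⟩ := (G' ρ θ u hρc huc hθc).1 hall
  exact absurd (H σ hσ hσ₂' T ρ θ u hE h1 h2 h3) (not_le.2 hT)

end DiluteSelfConsistencySmoothReduction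

open DiluteSelfConsistencySmoothReduction (holdsAt_of_not_smooth)

/-- **`DiluteSelfConsistency` IS ITS SMOOTH-PROFILE VERSION** : the continuity hypotheses of the crux are
vacuous extensions of smoothness — replacing `Continuous a₀/θ₀/u₀` by `Torus.IsSmooth` yields an equivalent statement.
This decides the standing disprover's mutation question (cdisprove cycle 1: "continuity hyps probably vacuous
extensions — undecidable cheaply"). -/
theorem diluteSelfConsistency_iff_smooth :
    DiluteSelfConsistency ↔
      ∀ η : ℝ, 0 < η → ∀ (a₀ θ₀ : T3 → ℝ) (u₀ : T3 → V3), Torus.IsSmooth a₀ → Torus.IsSmooth θ₀ →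
        Torus.IsSmooth u₀ → (∀ x, 0 < a₀ x) → (∀ x, 0 < θ₀ x) →
          ∃ σ₀ : ℝ, 0 < σ₀ ∧ DiluteSelfConsistencyHoldsAt η a₀ θ₀ u₀ σ₀ := by
  refine ⟨fun hD η hη a₀ θ₀ u₀ ha hθ hu ha0 hθ0 => hD η hη a₀ θ₀ u₀ ha.continuous hθ.continuous hu.continuous ha0 hθ0,
    fun hS η hη a₀ θ₀ u₀ ha hθ hu ha0 hθ0 => ?_⟩
  by_cases hs : Torus.IsSmooth a₀ ∧ Torus.IsSmooth θ₀ ∧ Torus.IsSmooth u₀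
  · exact hS η hη a₀ θ₀ u₀ hs.1 hs.2.1 hs.2.2 ha0 hθ0
  · exact holdsAt_of_not_smooth ha hθ hu ha0 hθ0 hs η

/-- **The particle-free form at smooth profiles** : `DiluteSelfConsistency` iff for every `η > 0` and all
SMOOTH positive profiles there is `σ₀ > 0` below which every classical hard-sphere-Euler solution with the pinned data
`(rhoLim (profileOf a₀) σ, u₀, θ₀)` keeps packing `< η` on `[0, T)`. -/
theorem diluteSelfConsistency_iff_pde_smooth :
    DiluteSelfConsistency ↔
      ∀ η : ℝ, 0 < η → ∀ (a₀ θ₀ : T3 → ℝ) (u₀ : T3 → V3) (ha : Torus.IsSmooth a₀) (ha0 : ∀ x, 0 < a₀ x),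
        Torus.IsSmooth θ₀ → Torus.IsSmooth u₀ → (∀ x, 0 < θ₀ x) →
        ∃ σ₀ : ℝ, 0 < σ₀ ∧ ∀ σ : ℝ, 0 < σ → σ < σ₀ →
          ∀ (T : ℝ) (ρ θ : ℝ → T3 → ℝ) (u : ℝ → T3 → V3), IsHardSphereEulerSolution σ T ρ u θ →
            ρ 0 = rhoLim (profileOf a₀ ha.continuous ha0) σ → u 0 = u₀ → θ 0 = θ₀ →
              ∀ t ∈ Ico 0 T, ∀ x, ρ t x * σ ^ 3 < η := by
  rw [diluteSelfConsistency_iff_pde]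
  refine ⟨fun hP η hη a₀ θ₀ u₀ ha ha0 hθ hu hθ0 => hP η hη a₀ θ₀ u₀ ha.continuous ha0 hθ.continuous hu.continuous hθ0,
    fun hS η hη a₀ θ₀ u₀ ha ha0 hθ hu hθ0 => ?_⟩
  by_cases hs : Torus.IsSmooth a₀ ∧ Torus.IsSmooth θ₀ ∧ Torus.IsSmooth u₀
  · exact hS η hη a₀ θ₀ u₀ hs.1 ha0 hs.2.1 hs.2.2 hθ0
  · obtain ⟨σ₀, hσ₀, H⟩ := stub_nonsmoothVacuous a₀ θ₀ u₀ ha ha0 hθ hu hθ0 hs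
    refine ⟨σ₀, hσ₀, fun σ hσ hσlt T ρ θ u hE h1 h2 h3 t ht _ => ?_⟩
    exact absurd (H σ hσ hσlt T ρ θ u hE h1 h2 h3) (not_le.2 (ht.1.trans_lt ht.2))

/-- **`DenseExcursion` NEEDS ONLY SMOOTH PROFILES** : the sibling crux (stmt-12586) is equivalent to its
version with `Torus.IsSmooth` profile witnesses — by the landed dichotomy `denseExcursion_iff_not_diluteSelfConsistency`
and `diluteSelfConsistency_iff_smooth`. -/
theorem denseExcursion_iff_smooth :
    DenseExcursion ↔
      ∃ η : ℝ, 0 < η ∧ ∃ (a₀ θ₀ : T3 → ℝ) (u₀ : T3 → V3), Torus.IsSmooth a₀ ∧ Torus.IsSmooth θ₀ ∧ Torus.IsSmooth u₀ ∧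
        (∀ x, 0 < a₀ x) ∧ (∀ x, 0 < θ₀ x) ∧ ∀ σ₀ : ℝ, 0 < σ₀ → ¬ DiluteSelfConsistencyHoldsAt η a₀ θ₀ u₀ σ₀ := by
  rw [denseExcursion_iff_not_diluteSelfConsistency, diluteSelfConsistency_iff_smooth]
  push Not
  constructor
  · rintro ⟨η, hη, a₀, θ₀, u₀, ha, hθ, hu, ha0, hθ0, H⟩
    exact ⟨η, hη, a₀, θ₀, u₀, ha, hθ, hu, ha0, hθ0, fun σ₀ hσ₀ => H σ₀ hσ₀⟩
  · rintro ⟨η, hη, a₀, θ₀, u₀, ha, hθ, hu, ha0, hθ0, H⟩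
    exact ⟨η, hη, a₀, θ₀, u₀, ha, hθ, hu, ha0, hθ0, fun σ₀ hσ₀ => H σ₀ hσ₀⟩


/-- **The rev-c2 cut of line `birth` is exact.** `DiluteSelfConsistency` is EQUIVALENT to the conjunction of the two
remaining registered stub statements (Cases I/II for SMOOTH profiles, verbatim): `→` restricts the particle-free form to
smooth profiles; `←` is the skeleton's composition with the landed smooth reduction (`stub_nonsmoothVacuous`). Hence a
refutation of either smooth Case at one profile refutes the crux, i.e. proves `DenseExcursion`
(`denseExcursion_of_not_smoothIdealFate`). [folklore] -/
theorem diluteSelfConsistency_iff_smoothIdealFate :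
    DiluteSelfConsistency ↔
      ((∀ η : ℝ, 0 < η → ∀ (a₀ θ₀ : T3 → ℝ) (u₀ : T3 → V3) (ha : Torus.IsSmooth a₀) (ha0 : ∀ x, 0 < a₀ x),
        Torus.IsSmooth θ₀ → Torus.IsSmooth u₀ → (∀ x, 0 < θ₀ x) →
        (∃ M : ℝ, ∀ (T₁ : ℝ) (ρ₁ θ₁ : ℝ → T3 → ℝ) (u₁ : ℝ → T3 → V3), IsHardSphereEulerSolution 0 T₁ ρ₁ u₁ θ₁ →
            (∀ x, ρ₁ 0 x = a₀ x / ∫ y, a₀ y) → u₁ 0 = u₀ → θ₁ 0 = θ₀ → ∀ t ∈ Ico 0 T₁, ∀ x, ρ₁ t x ≤ M) →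
        ∃ σ₀ : ℝ, 0 < σ₀ ∧ ∀ σ : ℝ, 0 < σ → σ < σ₀ →
          ∀ (T : ℝ) (ρ θ : ℝ → T3 → ℝ) (u : ℝ → T3 → V3), IsHardSphereEulerSolution σ T ρ u θ →
            ρ 0 = rhoLim (profileOf a₀ ha.continuous ha0) σ → u 0 = u₀ → θ 0 = θ₀ →
              ∀ t ∈ Ico 0 T, ∀ x, ρ t x * σ ^ 3 < η) ∧
      (∀ η : ℝ, 0 < η → ∀ (a₀ θ₀ : T3 → ℝ) (u₀ : T3 → V3) (ha : Torus.IsSmooth a₀) (ha0 : ∀ x, 0 < a₀ x),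
        Torus.IsSmooth θ₀ → Torus.IsSmooth u₀ → (∀ x, 0 < θ₀ x) →
        (¬ ∃ M : ℝ, ∀ (T₁ : ℝ) (ρ₁ θ₁ : ℝ → T3 → ℝ) (u₁ : ℝ → T3 → V3), IsHardSphereEulerSolution 0 T₁ ρ₁ u₁ θ₁ →
            (∀ x, ρ₁ 0 x = a₀ x / ∫ y, a₀ y) → u₁ 0 = u₀ → θ₁ 0 = θ₀ → ∀ t ∈ Ico 0 T₁, ∀ x, ρ₁ t x ≤ M) →
        ∃ σ₀ : ℝ, 0 < σ₀ ∧ ∀ σ : ℝ, 0 < σ → σ < σ₀ →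
          ∀ (T : ℝ) (ρ θ : ℝ → T3 → ℝ) (u : ℝ → T3 → V3), IsHardSphereEulerSolution σ T ρ u θ →
            ρ 0 = rhoLim (profileOf a₀ ha.continuous ha0) σ → u 0 = u₀ → θ 0 = θ₀ →
              ∀ t ∈ Ico 0 T, ∀ x, ρ t x * σ ^ 3 < η)) := by
  rw [diluteSelfConsistency_iff_pde_smooth]
  constructor
  · intro hP
    exact ⟨fun η hη a₀ θ₀ u₀ ha ha0 hθ hu hθ0 _ => hP η hη a₀ θ₀ u₀ ha ha0 hθ hu hθ0,
      fun η hη a₀ θ₀ u₀ ha ha0 hθ hu hθ0 _ => hP η hη a₀ θ₀ u₀ ha ha0 hθ hu hθ0⟩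
  · rintro ⟨hI, hII⟩ η hη a₀ θ₀ u₀ ha ha0 hθ hu hθ0
    by_cases hb : ∃ M : ℝ, ∀ (T₁ : ℝ) (ρ₁ θ₁ : ℝ → T3 → ℝ) (u₁ : ℝ → T3 → V3),
        IsHardSphereEulerSolution 0 T₁ ρ₁ u₁ θ₁ → (∀ x, ρ₁ 0 x = a₀ x / ∫ y, a₀ y) → u₁ 0 = u₀ → θ₁ 0 = θ₀ →
          ∀ t ∈ Ico 0 T₁, ∀ x, ρ₁ t x ≤ M
    · exact hI η hη a₀ θ₀ u₀ ha ha0 hθ hu hθ0 hb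
    · exact hII η hη a₀ θ₀ u₀ ha ha0 hθ hu hθ0 hb

/-- **Either smooth Case of line `birth` (rev c2) refuted ⇒ `DenseExcursion`.** [folklore] -/
theorem denseExcursion_of_not_smoothIdealFate
    (h : ¬ ((∀ η : ℝ, 0 < η → ∀ (a₀ θ₀ : T3 → ℝ) (u₀ : T3 → V3) (ha : Torus.IsSmooth a₀) (ha0 : ∀ x, 0 < a₀ x),
        Torus.IsSmooth θ₀ → Torus.IsSmooth u₀ → (∀ x, 0 < θ₀ x) →
        (∃ M : ℝ, ∀ (T₁ : ℝ) (ρ₁ θ₁ : ℝ → T3 → ℝ) (u₁ : ℝ → T3 → V3), IsHardSphereEulerSolution 0 T₁ ρ₁ u₁ θ₁ →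
            (∀ x, ρ₁ 0 x = a₀ x / ∫ y, a₀ y) → u₁ 0 = u₀ → θ₁ 0 = θ₀ → ∀ t ∈ Ico 0 T₁, ∀ x, ρ₁ t x ≤ M) →
        ∃ σ₀ : ℝ, 0 < σ₀ ∧ ∀ σ : ℝ, 0 < σ → σ < σ₀ →
          ∀ (T : ℝ) (ρ θ : ℝ → T3 → ℝ) (u : ℝ → T3 → V3), IsHardSphereEulerSolution σ T ρ u θ →
            ρ 0 = rhoLim (profileOf a₀ ha.continuous ha0) σ → u 0 = u₀ → θ 0 = θ₀ →
              ∀ t ∈ Ico 0 T, ∀ x, ρ t x * σ ^ 3 < η) ∧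
      (∀ η : ℝ, 0 < η → ∀ (a₀ θ₀ : T3 → ℝ) (u₀ : T3 → V3) (ha : Torus.IsSmooth a₀) (ha0 : ∀ x, 0 < a₀ x),
        Torus.IsSmooth θ₀ → Torus.IsSmooth u₀ → (∀ x, 0 < θ₀ x) →
        (¬ ∃ M : ℝ, ∀ (T₁ : ℝ) (ρ₁ θ₁ : ℝ → T3 → ℝ) (u₁ : ℝ → T3 → V3), IsHardSphereEulerSolution 0 T₁ ρ₁ u₁ θ₁ →
            (∀ x, ρ₁ 0 x = a₀ x / ∫ y, a₀ y) → u₁ 0 = u₀ → θ₁ 0 = θ₀ → ∀ t ∈ Ico 0 T₁, ∀ x, ρ₁ t x ≤ M) →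
        ∃ σ₀ : ℝ, 0 < σ₀ ∧ ∀ σ : ℝ, 0 < σ → σ < σ₀ →
          ∀ (T : ℝ) (ρ θ : ℝ → T3 → ℝ) (u : ℝ → T3 → V3), IsHardSphereEulerSolution σ T ρ u θ →
            ρ 0 = rhoLim (profileOf a₀ ha.continuous ha0) σ → u 0 = u₀ → θ 0 = θ₀ →
              ∀ t ∈ Ico 0 T, ∀ x, ρ t x * σ ^ 3 < η))) :
    DenseExcursion :=
  denseExcursion_iff_not_diluteSelfConsistency.2 fun hD => h (diluteSelfConsistency_iff_smoothIdealFate.1 hD)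

end Summit.AtomisticToContinuum.HydrodynamicLimit.Theorems

end
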